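import Summits.ResolutionOfSingularities.ResolutionOfSingularities.Theses.FrobeniusLadder
import Summits.ResolutionOfSingularities.ResolutionOfSingularities.Theorems.FrobeniusLadderFRationalModificationCertifiedModel
import Summits.ResolutionOfSingularities.ResolutionOfSingularities.Theorems.FrobeniusLadderFRationalModificationReduction
import HarnessLib

/-!
# Adapter: the proposed item `PointwiseCertifiedModification` closes the crux `FRationalModification`
(stmt-ResolutionOfSingularities-15316, line `birth` v5, lead c6, cycle 7)

The `def` is copied VERBATIM from `PromoteSignature.lean` (which elaborates over exactly the route file's
imports); `fRationalModification_of_item` is chain D (tree `PointwiseHull.fRationalModification_of_pointwiseHullOfRungTwo`,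
p143855) with the item's crux-style explicit hypotheses: once the planner files the item as a route decl
`Theses.FrobeniusLadder.<Item>`, the crux's closing file is this theorem with `h : <Item>` replaced by the
item's `_holds`/hypothesis, `--workitem stmt-ResolutionOfSingularities-15316`.
-/

-- single-problem summit: the doubled namespace component is forced
set_option linter.dupNamespace false

noncomputable section

open CategoryTheory AlgebraicGeometry IsLocalRing
open Summit.ResolutionOfSingularities.ResolutionOfSingularities.Theses.FrobeniusLadder
open Summit.ResolutionOfSingularities.ResolutionOfSingularities.Theorems.FRationalModification

namespace Summit.ResolutionOfSingularities.ResolutionOfSingularities.Cruxes.FRationalModification.Promote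

/-- PROPOSED ITEM (verbatim copy of `PromoteSignature.lean`). [cite: FedderWatanabe1989, Prop. 2.13] -/
def PointwiseCertifiedModification : Prop :=
  ∀ p : ℕ, p.Prime → ∀ (k : Type) [Field k] [CharP k p] (Y : AlgebraicGeometry.Scheme.{0}) (g : Y ⟶ AlgebraicGeometry.Spec (.of k)), AlgebraicGeometry.IsSeparated g → AlgebraicGeometry.LocallyOfFiniteType g → AlgebraicGeometry.QuasiCompact g → AlgebraicGeometry.IsIntegral Y → (∀ y : Y, IsDomain (Y.presheaf.stalk y) ∧ ∀ d : ℕ, ringKrullDim (Y.presheaf.stalk y) = d → ∀ s : Fin d → Y.presheaf.stalk y, (Ideal.span (Set.range s)).radical.IsMaximal → RingTheory.Sequence.IsWeaklyRegular (Y.presheaf.stalk y) (List.ofFn s) ∧ ∀ w : Y.presheaf.stalk y, (∃ e : ℕ, w ^ p ^ e ∈ Ideal.span ((fun z : Y.presheaf.stalk y => z ^ p ^ e) '' (Ideal.span (Set.range s) : Set (Y.presheaf.stalk y)))) → w ∈ Ideal.span (Set.range s)) → ∃ (W' : AlgebraicGeometry.Scheme.{0}) (π : W' ⟶ Y), AlgebraicGeometry.IsProper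 π ∧ Literature.AlgebraicGeometry.Resolution.IsBirational π ∧ ∀ w : W', IsRegularLocalRing (W'.presheaf.stalk w) ∨ (IsDomain (W'.presheaf.stalk w) ∧ ∃ t : W'.presheaf.stalk w, t ∈ IsLocalRing.maximalIdeal (W'.presheaf.stalk w) ∧ t ≠ 0 ∧ IsRegularRing (Localization.Away t) ∧ ∀ d : ℕ, ringKrullDim (W'.presheaf.stalk w ⧸ Ideal.span {t}) = d → ∀ u : Fin d → W'.presheaf.stalk w ⧸ Ideal.span {t}, (Ideal.span (Set.range u)).radical.IsMaximal → RingTheory.Sequence.IsWeaklyRegular (W'.presheaf.stalk w ⧸ Ideal.span {t}) (List.ofFn u) ∧ ∀ y : W'.presheaf.stalk w ⧸ Ideal.span {t}, (∃ e : ℕ, y ^ p ^ e ∈ Ideal.span ((fun z : W'.presheaf.stalk w ⧸ Ideal.span {t} => z ^ p ^ e) '' (Ideal.span (Set.range u) : Set (W'.presheaf.stalk w ⧸ Ideal.span {t})))) → y ∈ Ideal.span (Set.range u))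


/-- **The proposed item closes the crux** (chain D: reduce to the integral rung-2 components, regular
stalks are rung-3, certified stalks by the Fedder–Watanabe inversion with descended pointwise test
exponents). [cite: FedderWatanabe1989, Prop. 2.13; HochsterHuneke1989, Thm. 3.4] -/
theorem fRationalModification_of_item (h : PointwiseCertifiedModification) : FRationalModification := by
  intro p hp k _ _ X f hsep hft hqc _ hX₁
  haveI : Fact p.Prime := ⟨hp⟩
  haveI := hsep; haveI := hft; haveI := hqc
  refine Reduction.stub_reduction p k X f (fun Y g hs hl hq hY h₂ => ?_) hX₁
  haveI := hs; haveI := hl; haveI := hq; haveI := hY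
  obtain ⟨W', π', hπ', hbir', hcert⟩ := h p hp k Y g hs hl hq hY h₂
  haveI := hπ'
  refine ⟨W', π', inferInstance, hbir', fun w => ?_⟩
  haveI : CharP (W'.presheaf.stalk w) p := Negative.charP_stalk (π' ≫ g) w
  rcases hcert w with hreg | ⟨hdom, t, htm, ht0, haway, hc⟩
  · exact Negative.rungThree_of_isRegularLocalRing hp _ hreg
  · haveI := hdom
    exact ⟨hdom, CertifiedModel.rungThree_of_certificate p (π' ≫ g) w
      (Or.inr ⟨t, htm, ht0, haway, hc⟩)⟩

end Summit.ResolutionOfSingularities.ResolutionOfSingularities.Cruxes.FRationalModification.Promote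

end
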